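import Summits.BirchSwinnertonDyer.Rank1Residual.X11b.Three.CornerShapeGamma
import Literature.NumberTheory.EllipticCurves.Serre1972.PotentiallyGoodInertiaOrder
import HarnessLib

/-!
# Class X11b at `p = 3`, the non-surjective CORNER: no (T2γ)-carrier away from `2` — the named-fact
# form (team N8/O2 = cell `b2b-bsdres`, sub-target S14, seat x11b3-p6)

HONEST FRAMING (verbatim, cell `b2b-bsdres`): the cell deletes the COMBINATION-SHAPED residual
classes for ALL analytic-rank `≤ 1` curves over `ℚ` from PUBLISHED theorems only and TYPES the
construction-shaped ones; this is not "finishing BSD". Team N8/O2 (X11b at `3`; O2 OPEN). Research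
route; nothing booked; NO label changes. THEOREMS ONLY.

`CornerShapeGamma.lean` proves, for the corner `ClassX11b W 3 ∧ ¬ Surj W 3`, that every place of
Kodaira type `IV`/`IV*` lies over `2`, granted the per-pair hypothesis `hF` (Serre's inertia order
at the potentially good places `v ∣ ℓ ≥ 5`). This file instantiates `hF` with the NAMED FACT
`Literature.NumberTheory.EllipticCurves.Serre1972.inertiaOrder_dvd_card_range_galoisRepTorsion`
(Serre 1972 §5.6 as quoted verbatim by Martin–Watkins 2006 §3.1–§3.2), at `p = 3`: CONDITIONAL on
that one published fact, otherwise unconditional.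
-/

noncomputable section

open scoped Classical NumberField

open WeierstrassCurve NumberField IsDedekindDomain Literature.NumberTheory.EllipticCurves
  Rat.HeightOneSpectrum Literature.NumberTheory.DiophantineGeometry
  Literature.NumberTheory.EllipticCurves.Rank1Residual

namespace Summit.BirchSwinnertonDyer.Rank1Residual.X11b.Three

variable (W : WeierstrassCurve ℚ) [W.IsElliptic]

/-- Serre's fact at `p = 3` gives the per-pair hypothesis `hF` of `CornerShapeGamma`. [cite: MartinWatkins2006, §3.2] [cite: Serre1972, §5.6 (p. 312)] -/
theorem serre_hF_three [Fact (Nat.Prime 3)]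
    (hS : Serre1972.inertiaOrder_dvd_card_range_galoisRepTorsion) :
    ∀ v : HeightOneSpectrum (𝓞 ℚ), 5 ≤ (primesEquiv v : ℕ) → v.valuation ℚ W.j ≤ 1 →
      12 / Nat.gcd 12 (W.ordMinimalDiscriminant v) ∣ Nat.card (galoisRepTorsion W (3 : ℕ)).range :=
  fun v h5 hj ↦ hS W v 3 h5 (by decide) (by omega) hj

/-- **S14 with the named fact: on the corner of X11b@3 every place of Kodaira type `IV` or `IV*`
lies over `2`** (`ClassX11b W 3`, `¬ Surj W 3`; CONDITIONAL on Serre 1972 §5.6 =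
`Serre1972.inertiaOrder_dvd_card_range_galoisRepTorsion`). [cite: MartinWatkins2006, §3.2] [cite: Serre1972, §5.6 (p. 312) and §2.4 Prop. 15] -/
theorem primesEquiv_eq_two_of_not_surj_of_kodairaSymbolAt_IV_or_IVstar_of_serre [Fact (Nat.Prime 3)]
    (hS : Serre1972.inertiaOrder_dvd_card_range_galoisRepTorsion)
    (hX : ClassX11b W 3) (hns : ¬ Surj W 3) {v : HeightOneSpectrum (𝓞 ℚ)}
    (hk : W.kodairaSymbolAt v = .IV ∨ W.kodairaSymbolAt v = .IVstar) :
    (primesEquiv v : ℕ) = 2 :=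
  primesEquiv_eq_two_of_not_surj_of_kodairaSymbolAt_IV_or_IVstar W (serre_hF_three W hS) hX hns hk

/-- **S14, (T2γ) form with the named fact: on the corner a (T2γ)@3 witness lies over `2`.**
[cite: MartinWatkins2006, §3.2] [cite: Serre1972, §5.6 (p. 312)] -/
theorem shapeGamma_over_two_of_not_surj_of_serre [Fact (Nat.Prime 3)]
    (hS : Serre1972.inertiaOrder_dvd_card_range_galoisRepTorsion)
    (hX : ClassX11b W 3) (hns : ¬ Surj W 3) (hγ : ShapeGamma W) :
    ∃ v : HeightOneSpectrum (𝓞 ℚ), (primesEquiv v : ℕ) = 2 ∧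
      (W.kodairaSymbolAt v = .IV ∨ W.kodairaSymbolAt v = .IVstar) ∧ W.tamagawaNumberAt v = 3 :=
  shapeGamma_over_two_of_not_surj W (serre_hF_three W hS) hX hns hγ

/-- **S14, binder-list form with the named fact: on the corner there is NO place of type `IV`/`IV*`
over any `ℓ ≠ 2`.** [cite: MartinWatkins2006, §3.2] [cite: Serre1972, §5.6 (p. 312)] -/
theorem not_kodairaSymbolAt_IV_or_IVstar_of_not_surj_of_ne_two_of_serre [Fact (Nat.Prime 3)]
    (hS : Serre1972.inertiaOrder_dvd_card_range_galoisRepTorsion)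
    (hX : ClassX11b W 3) (hns : ¬ Surj W 3) {v : HeightOneSpectrum (𝓞 ℚ)}
    (hv : (primesEquiv v : ℕ) ≠ 2) :
    ¬ (W.kodairaSymbolAt v = .IV ∨ W.kodairaSymbolAt v = .IVstar) :=
  not_kodairaSymbolAt_IV_or_IVstar_of_not_surj_of_ne_two W (serre_hF_three W hS) hX hns hv

end Summit.BirchSwinnertonDyer.Rank1Residual.X11b.Three

end
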